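import Summits.BirchSwinnertonDyer.BirchSwinnertonDyer.Theses.ByReductionTypeAtTwo
import Summits.BirchSwinnertonDyer.Rank1Residual.X5.KatoOrdTwoMuPart
import Summits.BirchSwinnertonDyer.Rank1Residual.X5.TwoAdicTargetsEisenstein
import Summits.BirchSwinnertonDyer.Rank1Residual.X5.TwoAdicTargetsPub
import HarnessLib

/-!
# Route `ByReductionTypeAtTwo` (rung K4), crux `GoodOrdinaryRankZeroAtTwo`: the bridge with EVERY
# printed input a Literature named fact — the crux is the two halves of the `2`-adic main conjecture
# modulo PUBLISHED facts only (seat `bsd-2adic-ord`)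

HONEST FRAMING (cell `bsd-2adic`, run/shared/lean/pub/bsd-2adic/, HUMAN RULINGS D-0036/D-0059):
THEOREMS ONLY; nothing asserted; no definition; no new named fact. Companion of
`Theorems/ByReductionTypeAtTwoGoodOrdinaryInputs.lean`: there the Greenberg input was the Summits-side
typed slot `X5.O1.TwoAdicEulerCharRankZero W 0`; here it is the tree's PUBLISHED parity-free named fact
`Greenberg1999.thm41_charValue_rankZero_anyPrime` (Greenberg, LNM 1716, Thm. 4.1; `p = 2` carried by
Lemmas 4.6/4.7/4.11; kernel glue `X5.O1.twoAdicEulerCharRankZero_zero_of_greenberg`). So on the class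
"non-CM, analytic rank `0`, good ordinary at `2`" the crux is reduced, kernel-checked, to EXACTLY:

* four PUBLISHED named facts taken as hypotheses (conditional result): modularity
  `nonempty_modularParametrizationData`, Gross–Zagier–Kolyvagin `rank_eq_analyticRank_of_analyticRank_le_one`,
  Kato 2004 Thm. 17.4 (1)(2) at `p = 2` (`kato_divisibility_allPrimes W 2`, for every such `W` and its
  newform), Greenberg 1999 Thm. 4.1 parity-free (`Greenberg1999.thm41_charValue_rankZero_anyPrime`);
* two OPEN statements, ∀-closed over the class: the Kato-Néron half
  `X5.O1.MainConjectureLowerDivisibilityAtTwoOrd W` (≡ the `μ`-part `X5.O1.KatoMuPartAtTwo W` modulo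
  Kato 17.4 (1)(2)@2 and Néron integrality, `X5/KatoOrdTwoMuPart.lean`) and the Eisenstein half
  `X5.O1.MainConjectureEisensteinDivisibilityAtTwo W` — or, merged, `MazurMainConjecture W 2`.

PARTITION (D-0054): X5@2 good-ord (B1·O1; 611 book230 classes) × p = 2 — types-the-object-of; closes
none. References: [GreenbergLNM1716] Thm. 4.1; [Kato2004Asterisque] Thm. 17.4; [SkinnerUrban2014]
Conj. 3.6.8 (p odd); [Miller2011LMS] Def. 1.1.
-/

set_option autoImplicit false

noncomputable section

open scoped Classical MatrixGroups ModularForm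

open CongruenceSubgroup WeierstrassCurve Literature.NumberTheory.EllipticCurves
  Literature.NumberTheory.EllipticCurves.ModularForms
  Literature.NumberTheory.EllipticCurves.Rank1Residual
  Literature.NumberTheory.EllipticCurves.Rank1Residual.Typed
  Summit.BirchSwinnertonDyer.BirchSwinnertonDyer.Theorems.Rank1ResidualX1Defs
  Summit.BirchSwinnertonDyer.Rank1Residual.X5

namespace Summit.BirchSwinnertonDyer.BirchSwinnertonDyer.Theorems

open Summit.BirchSwinnertonDyer.BirchSwinnertonDyer.Theses.ByReductionTypeAtTwo

/-- **The crux `GoodOrdinaryRankZeroAtTwo` modulo PUBLISHED facts = the two halves of the `2`-adic main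
conjecture on the class.** Hypotheses: modularity, GZK, Kato 17.4 (1)(2)@2, Greenberg Thm. 4.1
parity-free (all four: tree named facts, PUBLISHED) and the two OPEN halves ∀-closed over non-CM,
analytic-rank-`0`, good-ordinary-at-`2` curves. Proof: Greenberg's fact gives the typed slot
`X5.O1.TwoAdicEulerCharRankZero W 0` (`twoAdicEulerCharRankZero_zero_of_greenberg`); the X5 doors give
the Miller halves; `missingPPartAt_of_lower_of_upper` + `bsdp_of_missingPPartAt`.
[cite: GreenbergLNM1716, Thm. 4.1 (p. 102)] [cite: Kato2004Asterisque, Thm. 17.4 (p. 273)]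
[cite: Miller2011LMS, Def. 1.1] -/
theorem goodOrdinaryRankZeroAtTwo_of_facts_of_halves
    (hmod : nonempty_modularParametrizationData)
    (hGZK : rank_eq_analyticRank_of_analyticRank_le_one)
    (h17 : ∀ (W : WeierstrassCurve ℚ) [W.IsElliptic] [W.IsGloballyMinimal]
      [NeZero (W.conductorNorm ℤ)] (f : CuspForm (Gamma0 (W.conductorNorm ℤ)) 2),
      kato_divisibility_allPrimes W 2 (f := f))
    (hGr : Greenberg1999.thm41_charValue_rankZero_anyPrime)
    (hK : ∀ (W : WeierstrassCurve ℚ) [W.IsElliptic] [W.IsGloballyMinimal],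
      ¬ W.HasCM → W.analyticRank = 0 → GoodOrd W 2 → O1.MainConjectureLowerDivisibilityAtTwoOrd W)
    (hE : ∀ (W : WeierstrassCurve ℚ) [W.IsElliptic] [W.IsGloballyMinimal],
      ¬ W.HasCM → W.analyticRank = 0 → GoodOrd W 2 →
        O1.MainConjectureEisensteinDivisibilityAtTwo W) :
    GoodOrdinaryRankZeroAtTwo := by
  unfold GoodOrdinaryRankZeroAtTwo
  intro W _ _ hcm hr hgo
  have hEC : O1.TwoAdicEulerCharRankZero W 0 := O1.twoAdicEulerCharRankZero_zero_of_greenberg W hGr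
  have hU : MissingUpperBoundAt W 2 :=
    O1.missingUpperBoundAt_two_of_mainConjectureLowerDivisibilityAtTwoOrd_of_kato W hEC hmod hGZK
      (fun f => h17 W f) hr hgo (hK W hcm hr hgo)
  have hL : MissingLowerBoundAt W 2 :=
    O1.missingLowerBoundAt_two_of_eisenstein_of_kato W hEC hmod hGZK (fun f => h17 W f) hr hgo
      (hE W hcm hr hgo)
  exact bsdp_of_missingPPartAt W 2 hGZK (by omega) (missingPPartAt_of_lower_of_upper W 2 hL hU)

/-- **One-child form modulo PUBLISHED facts: the `2`-adic cyclotomic main conjecture on the class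
implies the crux.** [cite: GreenbergLNM1716, Thm. 4.1 (p. 102)] [cite: Kato2004Asterisque, Thm. 17.4 (p. 273)]
[cite: CastellaGrossiSkinner2025, Introduction (MC) (shape)] -/
theorem goodOrdinaryRankZeroAtTwo_of_facts_of_mazurMainConjecture
    (hmod : nonempty_modularParametrizationData)
    (hGZK : rank_eq_analyticRank_of_analyticRank_le_one)
    (h17 : ∀ (W : WeierstrassCurve ℚ) [W.IsElliptic] [W.IsGloballyMinimal]
      [NeZero (W.conductorNorm ℤ)] (f : CuspForm (Gamma0 (W.conductorNorm ℤ)) 2),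
      kato_divisibility_allPrimes W 2 (f := f))
    (hGr : Greenberg1999.thm41_charValue_rankZero_anyPrime)
    (hMC : ∀ (W : WeierstrassCurve ℚ) [W.IsElliptic] [W.IsGloballyMinimal],
      ¬ W.HasCM → W.analyticRank = 0 → GoodOrd W 2 → MazurMainConjecture W 2) :
    GoodOrdinaryRankZeroAtTwo :=
  goodOrdinaryRankZeroAtTwo_of_facts_of_halves hmod hGZK h17 hGr
    (fun W _ _ hcm hr hgo =>
      O1.mainConjectureLowerDivisibilityAtTwoOrd_of_mazurMainConjecture W
        (fun _ => hMC W hcm hr hgo))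
    (fun W _ _ hcm hr hgo =>
      O1.mainConjectureEisensteinDivisibilityAtTwo_of_mazurMainConjecture W
        (fun _ => hMC W hcm hr hgo))

/-- **`μ`-part form modulo PUBLISHED facts**: the Kato-Néron half replaced by the `μ`-PART
`X5.O1.KatoMuPartAtTwo W` + per-curve Néron integrality of `ϖ·L₂(f,α)` (a certificate input, not
asserted), via `X5.O1.mainConjectureLowerDivisibilityAtTwoOrd_of_katoMuPartAtTwo`.
[cite: Kato2004Asterisque, Thm. 12.5 (4) (p. 222), Thm. 13.4 (3) (p. 226), Thm. 17.4 (3) (p. 273)]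
[cite: GreenbergLNM1716, Thm. 4.1 (p. 102)] -/
theorem goodOrdinaryRankZeroAtTwo_of_facts_of_katoMuPart_of_eisenstein
    (hmod : nonempty_modularParametrizationData)
    (hGZK : rank_eq_analyticRank_of_analyticRank_le_one)
    (h17 : ∀ (W : WeierstrassCurve ℚ) [W.IsElliptic] [W.IsGloballyMinimal]
      [NeZero (W.conductorNorm ℤ)] (f : CuspForm (Gamma0 (W.conductorNorm ℤ)) 2),
      kato_divisibility_allPrimes W 2 (f := f))
    (hGr : Greenberg1999.thm41_charValue_rankZero_anyPrime)
    (hint : ∀ (W : WeierstrassCurve ℚ) [W.IsElliptic] [W.IsGloballyMinimal],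
      ¬ W.HasCM → W.analyticRank = 0 → GoodOrd W 2 →
      ∀ [NeZero (W.conductorNorm ℤ)] (f : CuspForm (Gamma0 (W.conductorNorm ℤ)) 2),
        IsNewformOf W f → ∀ ϖ : ℚ, (ϖ : ℝ) * W.realPeriodRat = plusPeriod f →
          ∃ L₀ : IwasawaAlgebra 2, iwasawaToPowerSeries 2 L₀ =
            PowerSeries.C (ϖ : ℚ_[2]) * padicLFunction f (unitRoot W 2 : ℚ_[2]))
    (hμ : ∀ (W : WeierstrassCurve ℚ) [W.IsElliptic] [W.IsGloballyMinimal],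
      ¬ W.HasCM → W.analyticRank = 0 → GoodOrd W 2 → O1.KatoMuPartAtTwo W)
    (hE : ∀ (W : WeierstrassCurve ℚ) [W.IsElliptic] [W.IsGloballyMinimal],
      ¬ W.HasCM → W.analyticRank = 0 → GoodOrd W 2 →
        O1.MainConjectureEisensteinDivisibilityAtTwo W) :
    GoodOrdinaryRankZeroAtTwo :=
  goodOrdinaryRankZeroAtTwo_of_facts_of_halves hmod hGZK h17 hGr
    (fun W _ _ hcm hr hgo =>
      O1.mainConjectureLowerDivisibilityAtTwoOrd_of_katoMuPartAtTwo W (fun f => h17 W f)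
        (fun f hf ϖ hϖ => hint W hcm hr hgo f hf ϖ hϖ) (hμ W hcm hr hgo))
    hE

end Summit.BirchSwinnertonDyer.BirchSwinnertonDyer.Theorems

end
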